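import Literature.AlgebraicGeometry.Resolution.BlowupAlgebraStrictTransform
import HarnessLib

/-!
# [OURS · L1 W4.5(b) · EL♮] T-FIBRE-3: the TOOTH FORMULA on a blow-up chart — the controlled transform of
# `g = h + ϖk` (`h ∈ Iᵐ`, `k ∈ I^μ`, `μ ≤ m`) is `b^{m−μ}·H + ϖ·K`; modulo `ϖ` it is `b̄^{m−μ}·H̄`

HONEST FRAMING. OURS (cell res-hironaka, crux chain w45b, slot W4.5(b)); NOT a statement of any manuscript;
AI-written, weaker than expert review. Helper `--supports stmt-ResolutionOfSingularities-20038 --as helper`, after-care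
of the typed target T-FIBRE (`…EquisingularLiftNatNonCartierFibre` p508194, `…NonCartierFibreAmbient` p509919).
Kernel of res-L1-w45b-idea-2's **TOOTH FORMULA** (XDERIV 2026-08-27T07:20:07Z, by hand there: «on the O-smooth
`Bl_s(Ẽ)`, `St_s D = β*D − μ·E_s` with `μ = mult_{s_K} D_K ∈ [0, m]`, hence `(St_s D)_k = Γ′ + (m − μ)·e_q`
(`m = mult_q Γ`); chart form `g̃ ∈ (x,y)^μ ⇒ g̃(x, xy′) = x^μ G̃`, `G̃ mod ϖ = x^{m−μ}·G` — ONE line of divisor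
arithmetic, no case split (`μ = 0`: Δ/regular model, full tooth; `μ = m`: proximity lift, none)»).

CHART ALGEBRA (arbitrary commutative ring `R`; `I ⊆ R` the ideal of the centre — the section `s`; `b ∈ I` the
chart; `B = R[I/b] ⊆ R[1/b]` the affine blow-up algebra of the tree, `Literature/…/AffineBlowupAlgebra`; `ϖ ∈ R`
the uniformizer; for `f ∈ Iⁿ` the CONTROLLED TRANSFORM is the unique `F ∈ B` with `f = bⁿ·F`):
* `exists_controlledTransform`, `controlledTransform_unique'` — existence (`Iⁿ·B = (bⁿ)`) and uniqueness (`b` is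
  a non-zero-divisor of `B`);
* `mem_pow_of_mul_mem_of_sub_mem` — bookkeeping: `g ∈ I^μ`, `g − ϖk ∈ I^m ⊆ I^μ` and `ϖ` a non-zero-divisor
  modulo `I^μ` ⇒ `k ∈ I^μ`;
* **`controlledTransform_eq_of_add`** (TOOTH FORMULA, chart form): `g = h + ϖ·k`, `h = bᵐ·H`, `k = b^μ·K`,
  `g = b^μ·G`, `μ ≤ m` ⇒ `G = b^{m−μ}·H + ϖ·K` in `B`;
* **`mapQuotient_controlledTransform_eq`** — hence modulo `ϖ` (tree `blowupAlgebra.mapQuotient`, the chart of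
  the special fibre): `Ḡ = b̄^{m−μ}·H̄`, and `span_mapQuotient_controlledTransform_le`: `(Ḡ) ⊆ (b̄^{m−μ})`,
  `zeroLocus_exceptional_subset_zeroLocus_controlledTransform`: `V(b̄) ⊆ V(Ḡ)` for `μ < m` — for
  `μ < m` the whole exceptional line `V(b̄)` of the chart lies in `V(Ḡ)` (the TOOTH `(m − μ)·e_q`; `μ = 0 < m` is
  T-FIBRE's «`e_q ⊆ St(D)`», `μ = m` gives `Ḡ = H̄`, no tooth); user forms
  `mapQuotient_controlledTransform_eq_of_sub_mem` (`g ≡ h (mod ϖ)`, `ϖ` a non-zero-divisor mod `I^μ`) and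
  `…_of_isQuasiRegular` (`I = (c)` quasi-regular with `(I : ϖ) = I`, Matsumura 16.2 (ii)).
Geometric reading (index only): `R = 𝒪_{Ẽ,q}`, `I = (x, y)` the section `s_q`, `D = V(g)`, `Γ = D_k = V(ḡ)` with
`m = mult_q Γ` (`h ∈ Iᵐ` a lift of the leading part), `μ = mult_{s} D` (`g ∈ I^μ`), `G` = equation of `St_s D` on
the chart, `H̄` = equation of `Γ′ = Bl_q Γ` when `b̄ ∤ H̄`.

References: U. Görtz, T. Wedhorn, *Algebraic Geometry I*, (13.19), Prop. 13.96 (2) [GortzWedhorn2020]; The Stacks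
Project, Tag 07Z3 [StacksProject] — through the cited tree files. OURS planning texts (index only):
`L/res-L1-w45b-idea-2/XDERIV-g6-unibranch.md` (sha16 73278cd2cfa04fab).
-/

set_option linter.dupNamespace false -- mandated namespace `Summit.<Summit>.<Problem>` of this single-conjunct summit

noncomputable section

open Literature.AlgebraicGeometry.Resolution

universe u

namespace Summit.ResolutionOfSingularities.ResolutionOfSingularities.Cruxes.EquisingularLiftNat.Sections

variable {R : Type u} [CommRing R] (I : Ideal R) (b : R)

local notation3 "B" => blowupAlgebra I b
local notation3 "φ" => algebraMap R (blowupAlgebra I b)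

/-- **Controlled transforms exist**: for `b ∈ I` and `f ∈ Iⁿ` there is `F ∈ R[I/b]` with `f = bⁿ·F`
(`Iⁿ·R[I/b] = (bⁿ)`, Stacks 07Z3 (2)). [cite: StacksProject, Tag 07Z3 (2)] -/
theorem exists_controlledTransform (hb : b ∈ I) {n : ℕ} {f : R} (hf : f ∈ I ^ n) :
    ∃ F : B, φ f = φ b ^ n * F := by
  have h : φ f ∈ (I ^ n).map φ := Ideal.mem_map_of_mem _ hf
  rw [Ideal.map_pow, map_blowupAlgebra_eq_span hb, Ideal.span_singleton_pow,
    Ideal.mem_span_singleton'] at h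
  obtain ⟨F, hF⟩ := h
  exact ⟨F, by rw [← hF, mul_comm]⟩

/-- **Controlled transforms are unique**: `bⁿ·F = bⁿ·F'` in `R[I/b]` forces `F = F'` (`b` is a non-zero-divisor
of `R[I/b] ⊆ R[1/b]`, Stacks 07Z3 (1)). [cite: StacksProject, Tag 07Z3 (1)] -/
theorem controlledTransform_unique' {n : ℕ} {F F' : B} (h : φ b ^ n * F = φ b ^ n * F') : F = F' := by
  have hnzd : φ b ^ n ∈ nonZeroDivisors B := pow_mem algebraMap_mem_nonZeroDivisors_blowupAlgebra n
  exact (mul_cancel_left_mem_nonZeroDivisors hnzd).mp h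

omit b in
/-- Bookkeeping for the tooth formula: if `g ∈ I^μ`, `g − ϖ·k ∈ Iᵐ` with `μ ≤ m`, and `ϖ` is a
non-zero-divisor modulo `I^μ` (e.g. `(ϖ, x, y)` a regular sequence and `I = (x, y)`), then `k ∈ I^μ`. [folklore] -/
theorem mem_pow_of_mul_mem_of_sub_mem {ϖ g k : R} {μ m : ℕ} (hμm : μ ≤ m) (hg : g ∈ I ^ μ)
    (hgk : g - ϖ * k ∈ I ^ m) (hϖ : ∀ z, ϖ * z ∈ I ^ μ → z ∈ I ^ μ) : k ∈ I ^ μ := by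
  refine hϖ k ?_
  have h : ϖ * k = g - (g - ϖ * k) := by ring
  rw [h]
  exact sub_mem hg (Ideal.pow_le_pow_right hμm hgk)

/-- **TOOTH FORMULA, chart form** (res-L1-w45b-idea-2): in `R[I/b]`, if `g = h + ϖ·k` with controlled
transforms `g = b^μ·G`, `h = bᵐ·H`, `k = b^μ·K` and `μ ≤ m`, then `G = b^{m−μ}·H + ϖ·K` — cancel the
non-zero-divisor `b^μ` in `b^μ·G = b^μ·(b^{m−μ}·H + ϖ·K)`. [folklore] -/
theorem controlledTransform_eq_of_add {ϖ g h k : R} {μ m : ℕ} (hμm : μ ≤ m) (hghk : g = h + ϖ * k)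
    {G H K : B} (hG : φ g = φ b ^ μ * G) (hH : φ h = φ b ^ m * H) (hK : φ k = φ b ^ μ * K) :
    G = φ b ^ (m - μ) * H + φ ϖ * K := by
  refine controlledTransform_unique' I b (n := μ) ?_
  have hpow : φ b ^ m = φ b ^ μ * φ b ^ (m - μ) := by
    rw [← pow_add, Nat.add_sub_cancel' hμm]
  rw [← hG, hghk, map_add, map_mul, hH, hK, hpow]
  ring

/-- **TOOTH FORMULA modulo `ϖ`**: under the chart map of the special fibre
`R[I/b] → (R/ϖ)[Ī/b̄]` (tree `blowupAlgebra.mapQuotient`), the controlled transform `G` of `g = h + ϖ·k` goes to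
`b̄^{m−μ}·H̄`: «`(St_s D)_k = (m − μ)·e_q + Γ′` on the chart». [folklore] -/
theorem mapQuotient_controlledTransform_eq {ϖ g h k : R} {μ m : ℕ} (hμm : μ ≤ m) (hghk : g = h + ϖ * k)
    {G H K : B} (hG : φ g = φ b ^ μ * G) (hH : φ h = φ b ^ m * H) (hK : φ k = φ b ^ μ * K) :
    blowupAlgebra.mapQuotient I b (Ideal.span {ϖ}) G =
      algebraMap (R ⧸ Ideal.span {ϖ}) _ (Ideal.Quotient.mk (Ideal.span {ϖ}) b) ^ (m - μ) *
        blowupAlgebra.mapQuotient I b (Ideal.span {ϖ}) H := by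
  rw [controlledTransform_eq_of_add I b hμm hghk hG hH hK, map_add, map_mul, map_mul, map_pow,
    blowupAlgebra.mapQuotient_algebraMap, blowupAlgebra.mapQuotient_algebraMap,
    Ideal.Quotient.eq_zero_iff_mem.mpr (Ideal.mem_span_singleton_self ϖ), map_zero, zero_mul, add_zero]

/-- **The tooth**: modulo `ϖ` the equation `Ḡ` of the strict transform lies in `(b̄^{m−μ})`, so for `μ < m` the
whole exceptional line `V(b̄)` of the chart of the special fibre lies in `V(Ḡ)` (`m − μ` times); for `μ = 0 < m`
this is T-FIBRE's «`e_q ⊆ St(D)`», for `μ = m` (proximity lift) there is no tooth. [folklore] -/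
theorem span_mapQuotient_controlledTransform_le {ϖ g h k : R} {μ m : ℕ} (hμm : μ ≤ m)
    (hghk : g = h + ϖ * k) {G H K : B} (hG : φ g = φ b ^ μ * G) (hH : φ h = φ b ^ m * H)
    (hK : φ k = φ b ^ μ * K) :
    Ideal.span {blowupAlgebra.mapQuotient I b (Ideal.span {ϖ}) G} ≤
      Ideal.span {algebraMap (R ⧸ Ideal.span {ϖ}) (blowupAlgebra (I.map (Ideal.Quotient.mk (Ideal.span {ϖ})))
        (Ideal.Quotient.mk (Ideal.span {ϖ}) b)) (Ideal.Quotient.mk (Ideal.span {ϖ}) b) ^ (m - μ)} := by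
  rw [Ideal.span_singleton_le_iff_mem, mapQuotient_controlledTransform_eq I b hμm hghk hG hH hK]
  exact Ideal.mul_mem_right _ _ (Ideal.mem_span_singleton_self _)

/-- **The tooth, set form**: if `μ < m` then on the chart of the special fibre the exceptional line `V(b̄)` lies
in the zero locus `V(Ḡ)` of the strict-transform equation (`Ḡ ∈ (b̄^{m−μ}) ⊆ (b̄)`). [folklore] -/
theorem zeroLocus_exceptional_subset_zeroLocus_controlledTransform {ϖ g h k : R} {μ m : ℕ} (hμm : μ < m)
    (hghk : g = h + ϖ * k) {G H K : B} (hG : φ g = φ b ^ μ * G) (hH : φ h = φ b ^ m * H)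
    (hK : φ k = φ b ^ μ * K) :
    PrimeSpectrum.zeroLocus {algebraMap (R ⧸ Ideal.span {ϖ})
        (blowupAlgebra (I.map (Ideal.Quotient.mk (Ideal.span {ϖ}))) (Ideal.Quotient.mk (Ideal.span {ϖ}) b))
        (Ideal.Quotient.mk (Ideal.span {ϖ}) b)} ⊆
      PrimeSpectrum.zeroLocus {blowupAlgebra.mapQuotient I b (Ideal.span {ϖ}) G} := by
  intro P hP
  rw [PrimeSpectrum.mem_zeroLocus, Set.singleton_subset_iff] at hP ⊢
  have hle := span_mapQuotient_controlledTransform_le I b hμm.le hghk hG hH hK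
  rw [Ideal.span_singleton_le_span_singleton] at hle
  obtain ⟨c, hc⟩ := hle
  rw [SetLike.mem_coe, hc]
  exact Ideal.mul_mem_right _ _ (P.asIdeal.pow_mem_of_mem hP _ (Nat.sub_pos_of_lt hμm))

/-- **TOOTH FORMULA, user form**: `b ∈ I`, `g ∈ I^μ` with controlled transform `g = b^μ·G`, `h ∈ Iᵐ` with
`h = bᵐ·H`, `μ ≤ m`, `g ≡ h (mod ϖ)`, and `ϖ` a non-zero-divisor modulo `I^μ` (for `I = (x)` quasi-regular this is
`(I : ϖ) = I`, tree `IsQuasiRegular.mem_pow_of_mul_mem_pow`, Matsumura 16.2 (ii)) ⇒ modulo `ϖ` the strict-transform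
equation is `Ḡ = b̄^{m−μ}·H̄`. [folklore] -/
theorem mapQuotient_controlledTransform_eq_of_sub_mem (hb : b ∈ I) {ϖ g h : R} {μ m : ℕ} (hμm : μ ≤ m)
    (hg : g ∈ I ^ μ) (hh : h ∈ I ^ m) (hgh : g - h ∈ Ideal.span {ϖ})
    (hϖ : ∀ z, ϖ * z ∈ I ^ μ → z ∈ I ^ μ) {G H : B} (hG : φ g = φ b ^ μ * G) (hH : φ h = φ b ^ m * H) :
    blowupAlgebra.mapQuotient I b (Ideal.span {ϖ}) G =
      algebraMap (R ⧸ Ideal.span {ϖ}) _ (Ideal.Quotient.mk (Ideal.span {ϖ}) b) ^ (m - μ) *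
        blowupAlgebra.mapQuotient I b (Ideal.span {ϖ}) H := by
  obtain ⟨k, hk⟩ := Ideal.mem_span_singleton'.mp hgh
  have hghk : g = h + ϖ * k := by rw [mul_comm, hk]; ring
  have hkI : k ∈ I ^ μ :=
    mem_pow_of_mul_mem_of_sub_mem I hμm hg (by rw [hghk]; ring_nf; exact hh) hϖ
  obtain ⟨K, hK⟩ := exists_controlledTransform I b hb hkI
  exact mapQuotient_controlledTransform_eq I b hμm hghk hG hH hK

/-- **TOOTH FORMULA for a quasi-regular centre** (the situation of the chain: `I = (x, y)` the section, `(I : ϖ) = I`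
because `R/I ≅ O` is a domain not killed by `ϖ`): the non-zero-divisor hypothesis modulo `I^μ` is discharged by
Matsumura 16.2 (ii) (tree `IsQuasiRegular.mem_pow_of_mul_mem_pow`), so `g ∈ I^μ`, `h ∈ Iᵐ`, `g ≡ h (mod ϖ)`,
`μ ≤ m` ⇒ `Ḡ = b̄^{m−μ}·H̄` on the chart `b`. [cite: Matsumura1987, Thm. 16.2 (ii)] -/
theorem mapQuotient_controlledTransform_eq_of_isQuasiRegular {ι : Type*} (c : ι → R) (hc : IsQuasiRegular c)
    {b : R} (hb : b ∈ Ideal.span (Set.range c)) {ϖ g h : R} {μ m : ℕ} (hμm : μ ≤ m)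
    (hg : g ∈ Ideal.span (Set.range c) ^ μ) (hh : h ∈ Ideal.span (Set.range c) ^ m)
    (hgh : g - h ∈ Ideal.span {ϖ})
    (hcolon : ∀ z, ϖ * z ∈ Ideal.span (Set.range c) → z ∈ Ideal.span (Set.range c))
    {G H : blowupAlgebra (Ideal.span (Set.range c)) b}
    (hG : algebraMap R _ g = algebraMap R _ b ^ μ * G) (hH : algebraMap R _ h = algebraMap R _ b ^ m * H) :
    blowupAlgebra.mapQuotient (Ideal.span (Set.range c)) b (Ideal.span {ϖ}) G =
      algebraMap (R ⧸ Ideal.span {ϖ}) _ (Ideal.Quotient.mk (Ideal.span {ϖ}) b) ^ (m - μ) *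
        blowupAlgebra.mapQuotient (Ideal.span (Set.range c)) b (Ideal.span {ϖ}) H :=
  mapQuotient_controlledTransform_eq_of_sub_mem _ b hb hμm hg hh hgh
    (fun _ hz => hc.mem_pow_of_mul_mem_pow hcolon μ hz) hG hH

end Summit.ResolutionOfSingularities.ResolutionOfSingularities.Cruxes.EquisingularLiftNat.Sections

end
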